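import Summits.QuantumAdvantage.QuantumAdvantage.Theses.OddPrimeWalk

/-!
# Route OddPrimeWalk — `Assembly` (item stmt-QuantumAdvantage-22735), proved

`Assembly := ShotsOdd → DenseResidualOdd → DichotomyGlue → BridgeOdd → ∀ p prime, 5 ≤ p → AdviceFreeQNC0Sep p`:
the dichotomy glue turns the two regimes into `WalkHardF p`, and the bridge turns `WalkHardF p` into the
separation.  Pure logic — the same term as the route's deciding theorem `closes` (planner qa-qnc0-p2 g15;
seat qa-qnc0-prover gen 10).  `DenseResidualOdd` stays a hypothesis (open).
-/

set_option linter.dupNamespace false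

namespace Summit.QuantumAdvantage.QuantumAdvantage.Theorems

/-- Item stmt-QuantumAdvantage-22735 `Assembly` of route OddPrimeWalk: shots rung + dense residual + glue +
bridge give `AdviceFreeQNC0Sep p` for every prime `p ≥ 5`. -/
theorem assembly_proof : Summit.QuantumAdvantage.QuantumAdvantage.Theses.OddPrimeWalk.Assembly :=
  fun hSh hR hG hB p _ hp => hB p hp (hG hSh hR p hp)

end Summit.QuantumAdvantage.QuantumAdvantage.Theorems
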